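import Summits.AtomisticToContinuum.BoseEinsteinCondensation.Theorems.BECCutLineWeakDisorderTwoReplicaTransienceBoundFactorisation
import Summits.AtomisticToContinuum.BoseEinsteinCondensation.Theorems.BECCutLineWeakDisorderTwoReplicaTransienceBoundFreeOneTools
import Summits.AtomisticToContinuum.BoseEinsteinCondensation.Theorems.TwoReplicaTransienceBound.Negative.ConstantAtLeastOne
import HarnessLib

/-!
# Crux `TwoReplicaTransienceBound` (stmt-AtomisticToContinuum-9687), line `SketchIdeator1` v6:
# the SLICE BOUND and the reduction of the crux integral to `L³ ‖Z_n‖₂²` (stub `stub_sliceBound`)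

Support file (`--supports stmt-AtomisticToContinuum-9687`, lead c3). The upper sandwich of the passive tracer, `tracer ≤ 1`,
in the line's factorisation `Z_{n+1}(x::Y) = ∫ w(Y,ωb)·tracer(x,Y,ωb) dW` gives the slice bound `Z_{n+1}(x::Y) ≤ Z_n(Y)` at the
SAME box, hence `m(Y) ≤ Z_n(Y) s(Y)` and, for the un-normalised crux integrand, `L³ m²/s² ≤ L³ Z_n(Y)²`; integrating,
`∫ L³ m²/s² ≤ L³ ‖Z_n‖₂²` (`lintegral_ratio_le`). After normalisation by `‖Z_{n+1}‖₂²` the crux integral is thus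
`≤ L³ N_n/N_{n+1}` — affordable exactly as long as inserting one line costs `O(L⁻³)·O(1)`, i.e. on the short-time windows of
`…ShortTime.lean` / `…ShortTimeBounded.lean`, which both import this file. Also here: one particle does not interact
(`N_1` is `v`-independent), zero particles have `N_0 ≤ 1`, and the numerical constant `16 ≤ 20 q₀`.
-/

noncomputable section

open MeasureTheory Filter Set
open scoped ENNReal NNReal Topology BigOperators

namespace Summit.AtomisticToContinuum.BoseEinsteinCondensation.Cruxes.TwoReplicaTransienceBound.ShortTime

open Literature.MathematicalPhysics.QuantumManyBody.BoseGas
open Summit.AtomisticToContinuum.BoseEinsteinCondensation.Theorems.CutLineWitness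
open Summit.AtomisticToContinuum.BoseEinsteinCondensation.Cruxes.TwoReplicaTransienceBound.TracerDecoupling

variable {n : ℕ}

/-! ### The slice bound and the reduction of the crux integral to `L³ N_n / N_{n+1}` -/

/-- **Slice bound**: `Z_{n+1}(x :: Y) ≤ Z_n(Y)` — factorise through the tracer (`stub_factorisation`) and use
`tracer ≤ 1` (drop the tagged line altogether). -/
theorem fkPartition_vecCons_le {v : ℝ → ℝ≥0∞} (hv : Measurable v) (L T : ℝ) (x : Space) (Y : Config n) :
    fkPartition v L T (Matrix.vecCons x Y) ≤ fkPartition v L T Y := by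
  rw [stub_factorisation n v hv L T x Y]
  calc ∫⁻ ωb, fkWeight v L T Y ωb * tracer v L T x Y ωb ∂wienerPaths n
      ≤ ∫⁻ ωb, fkWeight v L T Y ωb * 1 ∂wienerPaths n :=
        lintegral_mono fun ωb => mul_le_mul' le_rfl (tracer_le_one v L T x Y ωb)
    _ = fkPartition v L T Y := by simp only [fkPartition, fkSemigroup, mul_one]

/-- **The un-normalised crux integral is at most `L³ ‖Z_n‖₂²`**: slice by slice `m(Y) ≤ Z_n(Y) s(Y)`
(`fkPartition_vecCons_le`), so `L³ m²/s² ≤ L³ Z_n(Y)²` (`mul_sq_div_sq_le`), and `∫ Z_n² = ‖Z_n‖₂²`. -/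
theorem lintegral_ratio_le {v : ℝ → ℝ≥0∞} (hv : Measurable v) (L T : ℝ) :
    ∫⁻ Y : Config n, ENNReal.ofReal (L ^ 3) * (∫⁻ x, fkPartition v L T (Matrix.vecCons x Y) ^ 2) ^ 2 /
        (∫⁻ x, fkPartition v L T (Matrix.vecCons x Y)) ^ 2 ≤
      ENNReal.ofReal (L ^ 3) * fkNormSq (N := n) v L T (fun _ => (1 : ℝ≥0∞)) := by
  have hm : ∀ Y : Config n, ∫⁻ x, fkPartition v L T (Matrix.vecCons x Y) ^ 2 ≤
      fkPartition v L T Y * ∫⁻ x, fkPartition v L T (Matrix.vecCons x Y) := by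
    intro Y
    have hmeas : Measurable fun x : Space => fkPartition v L T (Matrix.vecCons x Y) :=
      (measurable_fkSemigroup hv L T measurable_const).comp (measurable_vecCons_left Y)
    rw [← lintegral_const_mul _ hmeas]
    refine lintegral_mono fun x => ?_
    rw [sq]
    exact mul_le_mul' (fkPartition_vecCons_le hv L T x Y) le_rfl
  calc ∫⁻ Y : Config n, ENNReal.ofReal (L ^ 3) * (∫⁻ x, fkPartition v L T (Matrix.vecCons x Y) ^ 2) ^ 2 /
          (∫⁻ x, fkPartition v L T (Matrix.vecCons x Y)) ^ 2
      ≤ ∫⁻ Y : Config n, ENNReal.ofReal (L ^ 3) * fkPartition v L T Y ^ 2 :=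
        lintegral_mono fun Y => mul_sq_div_sq_le (hm Y)
    _ = ENNReal.ofReal (L ^ 3) * fkNormSq (N := n) v L T (fun _ => (1 : ℝ≥0∞)) := by
        have hZ2 : Measurable fun Y : Config n => fkPartition v L T Y ^ 2 :=
          (measurable_fkSemigroup hv L T measurable_const).pow_const 2
        rw [lintegral_const_mul _ hZ2]
        rfl

/-! ### One and zero particles -/

/-- One particle does not interact: `‖e^{-TH_1}1‖₂²` does not depend on `v`. -/
theorem fkNormSq_one_particle (v : ℝ → ℝ≥0∞) (L T : ℝ) :
    fkNormSq (N := 1) v L T (fun _ => (1 : ℝ≥0∞)) = fkNormSq (N := 1) (fun _ => 0) L T (fun _ => (1 : ℝ≥0∞)) := by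
  change ∫⁻ X, fkPartition v L T X ^ 2 = ∫⁻ X, fkPartition (fun _ => 0) L T X ^ 2
  simp only [FreeGas.fkPartition_config_one]

/-- Zero particles: `‖e^{-TH_0}1‖₂² ≤ 1` (the configuration space of no particle is a point). -/
theorem fkNormSq_zero_particle_le (v : ℝ → ℝ≥0∞) (L T : ℝ) :
    fkNormSq (N := 0) v L T (fun _ => (1 : ℝ≥0∞)) ≤ 1 := by
  change ∫⁻ X, fkPartition v L T X ^ 2 ≤ 1
  calc ∫⁻ X : Config 0, fkPartition v L T X ^ 2 ≤ ∫⁻ _X : Config 0, 1 :=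
        lintegral_mono fun X => by
          calc fkPartition v L T X ^ 2 ≤ 1 ^ 2 := pow_le_pow_left' (fkPartition_le_one v L T X) 2
            _ = 1 := one_pow 2
    _ = 1 := by
        rw [lintegral_const, one_mul, volume_pi, Measure.pi_univ]
        simp

/-! ### Numerical constants -/

/-- `16 ≤ 20 q₀`, `q₀ = 1 - 6e⁻⁵` (from `e ≥ 2`, `e⁵ ≥ 32`). -/
theorem sixteen_le_twenty_mul_q0 : 16 ≤ 20 * (1 - 6 * Real.exp (-5)) := by
  have h1 : (2 : ℝ) ≤ Real.exp 1 := by have := Real.add_one_le_exp (1 : ℝ); linarith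
  have h5 : (32 : ℝ) ≤ Real.exp 5 := by
    have h := pow_le_pow_left₀ (by norm_num : (0 : ℝ) ≤ 2) h1 5
    rw [Real.exp_one_pow] at h
    norm_num at h
    exact_mod_cast h
  have hpos : 0 < Real.exp 5 := Real.exp_pos 5
  rw [Real.exp_neg]
  have : Real.exp 5 * (Real.exp 5)⁻¹ = 1 := mul_inv_cancel₀ hpos.ne'
  nlinarith [inv_pos.2 hpos]

end Summit.AtomisticToContinuum.BoseEinsteinCondensation.Cruxes.TwoReplicaTransienceBound.ShortTime

namespace Summit.AtomisticToContinuum.BoseEinsteinCondensation.Cruxes.TwoReplicaTransienceBound.TracerDecoupling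

open Literature.MathematicalPhysics.QuantumManyBody.BoseGas

/-- **Registered toolbox stub `stub_sliceBound`** (crux stmt-AtomisticToContinuum-9687, line `SketchIdeator1` v6): the
un-normalised crux integral is at most `L³ ‖Z_n‖₂²` (`= ShortTime.lintegral_ratio_le`; slice bound `Z_{n+1}(x::Y) ≤ Z_n(Y)`). -/
theorem stub_sliceBound :
    ∀ (n : ℕ) (v : ℝ → ENNReal), Measurable v → ∀ (L T : ℝ),
      ∫⁻ Y : Config n, ENNReal.ofReal (L ^ 3) * (∫⁻ x, fkPartition v L T (Matrix.vecCons x Y) ^ 2) ^ 2 /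
          (∫⁻ x, fkPartition v L T (Matrix.vecCons x Y)) ^ 2 ≤
        ENNReal.ofReal (L ^ 3) * @fkNormSq n v L T (fun _ => (1 : ENNReal)) :=
  fun _ _ hv L T => ShortTime.lintegral_ratio_le hv L T

end Summit.AtomisticToContinuum.BoseEinsteinCondensation.Cruxes.TwoReplicaTransienceBound.TracerDecoupling

end
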